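import Literature.NumberTheory.LFunctions.LogFreeDensityLocal
import Literature.Analysis.Complex.LogDerivZerosDisc
import HarnessLib

/-!
# Bombieri's local lemmas for an abstract `L`-function (Lemme de densité, derivatives of `F'/F`)

Topic `Literature/NumberTheory/LFunctions`, namespace `Literature.NumberTheory.LFunctions.LogFreeLocal`.
Everything here is PROVED (theorems only; no named facts).

The two local inputs of Bombieri's Lemme A (*Le grand crible*, §6, pp. 42–45), proved in the tree
for Dirichlet `L`-functions in `LogFreeDensityLocal.lean`, are re-proved here for an ABSTRACT function
`f` analytic on the disc `|s − c| ≤ 2`, `c = 2 + iv`, whose local partial fraction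
`|f'/f(z) − Σ_{ρ} m(ρ)/(z − ρ)| ≤ E` holds on `|z − c| ≤ 7/4` off the zeros (`ρ` over the zeros of `f`
in `|ρ − c| ≤ 31/16` with multiplicities `m = divisor`), so that they apply verbatim to the class group
`L`-functions of a number field (inputs `ClassGroupLFunctionZeroCount.norm_logDeriv_classTwistedZeta₁_sub_sum_le`
and its `L₀`-variant) — and to any other family with such a package:

* `sum_near_le` — **Lemme de densité**: if moreover `|f'/f(1 + r + iv)| ≤ 1/r + K₀` (`0 < r`)
  and all zeros in the disc have `Re ρ ≤ 1`, then `Σ_{|ρ − (1+iv)| ≤ r} m(ρ) ≤ 4 + 4rK₀ + 4rE`;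
* `norm_iteratedDeriv_logDeriv_sub_le` — **Cauchy for the remainder**: for `|s₀ − c| ≤ 3/2` with
  `f(s₀) ≠ 0` and every `k`, `|(f'/f)^{(k)}(s₀) − (−1)^k k! Σ_ρ m(ρ)/(s₀ − ρ)^{k+1}| ≤ k! 16^k E`.

## References

* [Bombieri1987GrandCrible] E. Bombieri, *Le grand crible dans la théorie analytique des nombres*,
  Astérisque 18 (1987), §6, Lemme de densité (p. 42), Lemme A (pp. 43–45).
-/

noncomputable section

open Complex Metric Set Filter Finset
open scoped Real Topology

namespace Literature.NumberTheory.LFunctions.LogFreeLocal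

open Literature.NumberTheory.LFunctions.LogFreeDensity

variable {f : ℂ → ℂ} {v : ℝ}

/-- The multiplicities. [folklore] -/
def discDivisor (f : ℂ → ℂ) (v : ℝ) :
    Function.locallyFinsuppWithin (closedBall (2 + (v : ℂ) * I) (31 / 16)) ℤ :=
  MeromorphicOn.divisor f (closedBall (2 + (v : ℂ) * I) (31 / 16))

/-- The zeros of `f` in `|ρ − (2 + iv)| ≤ 31/16`, as a finset (support of the divisor). [folklore] -/
def discZeros (f : ℂ → ℂ) (v : ℝ) : Finset ℂ :=
  ((discDivisor f v).finiteSupport (isCompact_closedBall _ _)).toFinset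

/-- The order of vanishing of the entire `f`. [folklore] -/
def zeroOrder (f : ℂ → ℂ) (u : ℂ) : ℕ := analyticOrderNatAt f u

/-- An entire `f` with `f(c) ≠ 0` has finite order everywhere. [folklore] -/
theorem analyticOrderAt_ne_top (hf : Differentiable ℂ f) {c : ℂ} (hc : f c ≠ 0) (u : ℂ) :
    analyticOrderAt f u ≠ ⊤ := by
  intro htop
  have h0 : f =ᶠ[𝓝 u] 0 := analyticOrderAt_eq_top.mp htop
  have hall : AnalyticOnNhd ℂ f univ := fun z _ ↦ hf.analyticAt z
  have := hall.eqOn_zero_of_preconnected_of_eventuallyEq_zero isPreconnected_univ (mem_univ u) h0 (mem_univ c)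
  exact hc this

/-- `m(u) ≥ 1 ↔ f(u) = 0`. [folklore] -/
theorem zeroOrder_pos_iff (hf : Differentiable ℂ f) {c : ℂ} (hc : f c ≠ 0) (u : ℂ) :
    0 < zeroOrder f u ↔ f u = 0 := by
  have han : AnalyticAt ℂ f u := hf.analyticAt u
  rw [zeroOrder, pos_iff_ne_zero, ne_eq, ← Nat.cast_inj (R := ℕ∞),
    Nat.cast_analyticOrderNatAt (analyticOrderAt_ne_top hf hc u), Nat.cast_zero,
    han.analyticOrderAt_eq_zero, not_not]

/-- `m(u) = (meromorphicOrderAt f u).untop₀`. [folklore] -/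
theorem meromorphicOrderAt_untop₀_eq_zeroOrder (hf : Differentiable ℂ f) {c : ℂ} (hc : f c ≠ 0) (u : ℂ) :
    (meromorphicOrderAt f u).untop₀ = (zeroOrder f u : ℤ) := by
  have han : AnalyticAt ℂ f u := hf.analyticAt u
  rw [han.meromorphicOrderAt_eq, zeroOrder, ← Nat.cast_analyticOrderNatAt (analyticOrderAt_ne_top hf hc u)]
  simp

/-- `f` is analytic on every closed disc. [folklore] -/
theorem analyticOnNhd_of_differentiable (hf : Differentiable ℂ f) (c : ℂ) (R : ℝ) :
    AnalyticOnNhd ℂ f (closedBall c R) := fun z _ ↦ hf.analyticAt z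

/-- The divisor is the order of vanishing. [folklore] -/
theorem discDivisor_eq_zeroOrder (hf : Differentiable ℂ f) (hc : f (2 + (v : ℂ) * I) ≠ 0) {u : ℂ}
    (hu : u ∈ closedBall (2 + (v : ℂ) * I) (31 / 16)) :
    discDivisor f v u = (zeroOrder f u : ℤ) := by
  rw [discDivisor, MeromorphicOn.divisor_apply (analyticOnNhd_of_differentiable hf _ _).meromorphicOn hu,
    meromorphicOrderAt_untop₀_eq_zeroOrder hf hc]

/-- Multiplicities are `≥ 0`. [folklore] -/
theorem discDivisor_nonneg (hf : Differentiable ℂ f) (v : ℝ) (u : ℂ) : 0 ≤ discDivisor f v u :=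
  MeromorphicOn.AnalyticOnNhd.divisor_nonneg (analyticOnNhd_of_differentiable hf _ _) u

/-- **Membership**: `u ∈ discZeros f v ↔ |u − (2+iv)| ≤ 31/16 ∧ f(u) = 0`. [folklore] -/
theorem mem_discZeros (hf : Differentiable ℂ f) (hc : f (2 + (v : ℂ) * I) ≠ 0) {u : ℂ} :
    u ∈ discZeros f v ↔ u ∈ closedBall (2 + (v : ℂ) * I) (31 / 16) ∧ f u = 0 := by
  rw [discZeros, Set.Finite.mem_toFinset, Function.mem_support]
  change discDivisor f v u ≠ 0 ↔ _
  constructor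
  · intro h
    have hu : u ∈ closedBall (2 + (v : ℂ) * I) (31 / 16) :=
      (discDivisor f v).supportWithinDomain (Function.mem_support.2 h)
    refine ⟨hu, ?_⟩
    rw [discDivisor_eq_zeroOrder hf hc hu] at h
    have h' : 0 < zeroOrder f u := by
      rcases Nat.eq_zero_or_pos (zeroOrder f u) with h0 | h0
      · rw [h0] at h; simp at h
      · exact h0
    exact (zeroOrder_pos_iff hf hc u).1 h'
  · rintro ⟨hu, h0⟩
    rw [discDivisor_eq_zeroOrder hf hc hu]
    have := (zeroOrder_pos_iff hf hc u).2 h0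
    exact_mod_cast this.ne'

/-- Elements of `discZeros` have weight `m(ρ) = zeroOrder ≥ 1`. [folklore] -/
theorem one_le_discDivisor (hf : Differentiable ℂ f) (hc : f (2 + (v : ℂ) * I) ≠ 0) {ρ : ℂ}
    (h : ρ ∈ discZeros f v) : 1 ≤ discDivisor f v ρ := by
  obtain ⟨h1, h2⟩ := (mem_discZeros hf hc).1 h
  rw [discDivisor_eq_zeroOrder hf hc h1]
  exact_mod_cast (zeroOrder_pos_iff hf hc ρ).2 h2

/-! ### Lemme de densité -/

/-- **Lemme de densité** (Bombieri p. 42), abstract: with `s = 1 + r + iv`, `0 < r ≤ 1/4`, if all zeros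
in the disc have `Re ρ ≤ 1`, `|f'/f(s) − Σ m(ρ)/(s−ρ)| ≤ E` and `|f'/f(s)| ≤ 1/r + K₀`, then
`Σ_{|ρ−(1+iv)| ≤ r} m(ρ) ≤ 4 + 4rK₀ + 4rE`. [cite: Bombieri1987GrandCrible, §6 Lemme de densité] -/
theorem sum_near_le (hf : Differentiable ℂ f) {E K₀ r : ℝ} (hr : 0 < r) (hre : ∀ ρ ∈ discZeros f v, ρ.re ≤ 1)
    (hpf : ‖logDeriv f (((1 + r : ℝ) : ℂ) + (v : ℂ) * I) -
        ∑ ρ ∈ discZeros f v, (discDivisor f v ρ : ℂ) / ((((1 + r : ℝ) : ℂ) + (v : ℂ) * I) - ρ)‖ ≤ E)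
    (hld : ‖logDeriv f (((1 + r : ℝ) : ℂ) + (v : ℂ) * I)‖ ≤ 1 / r + K₀) :
    ∑ ρ ∈ (discZeros f v).filter (fun ρ => ‖ρ - (1 + (v : ℂ) * I)‖ ≤ r),
        (discDivisor f v ρ : ℝ) ≤ 4 + 4 * r * K₀ + 4 * r * E := by
  classical
  set s : ℂ := (1 + r : ℝ) + (v : ℂ) * I with hs
  have hsre : s.re = 1 + r := by simp [hs]
  set Sz : ℂ := ∑ ρ ∈ discZeros f v, (discDivisor f v ρ : ℂ) / (s - ρ) with hSz
  have hA : ‖Sz‖ ≤ 1 / r + K₀ + E := by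
    have hsplit : Sz = logDeriv f s - (logDeriv f s - Sz) := by ring
    calc ‖Sz‖ = ‖logDeriv f s - (logDeriv f s - Sz)‖ := by rw [← hsplit]
      _ ≤ ‖logDeriv f s‖ + ‖logDeriv f s - Sz‖ := norm_sub_le _ _
      _ ≤ (1 / r + K₀) + E := add_le_add hld hpf
  have hRe : Sz.re ≤ 1 / r + K₀ + E := (Complex.re_le_norm _).trans hA
  have hRe_eq : Sz.re = ∑ ρ ∈ discZeros f v, (discDivisor f v ρ : ℝ) * ((s - ρ)⁻¹).re := by
    rw [hSz, Complex.re_sum]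
    refine Finset.sum_congr rfl fun ρ _ => ?_
    rw [div_eq_mul_inv, show ((discDivisor f v ρ : ℤ) : ℂ) = (((discDivisor f v ρ : ℤ) : ℝ) : ℂ) by
      norm_cast, Complex.re_ofReal_mul]
  have hterm0 : ∀ ρ ∈ discZeros f v, 0 ≤ (discDivisor f v ρ : ℝ) * ((s - ρ)⁻¹).re := by
    intro ρ hρ
    have hm : (0 : ℝ) ≤ discDivisor f v ρ := by exact_mod_cast discDivisor_nonneg hf v ρ
    refine mul_nonneg hm (re_inv_sub_nonneg ?_)
    rw [hsre]; linarith [hre ρ hρ]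
  have hnear : ∀ ρ ∈ (discZeros f v).filter (fun ρ => ‖ρ - (1 + (v : ℂ) * I)‖ ≤ r),
      (discDivisor f v ρ : ℝ) * (1 / (4 * r)) ≤ (discDivisor f v ρ : ℝ) * ((s - ρ)⁻¹).re := by
    intro ρ hρ
    rw [Finset.mem_filter] at hρ
    have hm : (0 : ℝ) ≤ discDivisor f v ρ := by exact_mod_cast discDivisor_nonneg hf v ρ
    refine mul_le_mul_of_nonneg_left ?_ hm
    have hre' : r ≤ (s - ρ).re := by
      rw [sub_re, hsre]; linarith [hre ρ hρ.1]
    have hnorm : ‖s - ρ‖ ≤ 2 * r := by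
      calc ‖s - ρ‖ = ‖(s - (1 + (v : ℂ) * I)) + ((1 + (v : ℂ) * I) - ρ)‖ := by ring_nf
        _ ≤ ‖s - (1 + (v : ℂ) * I)‖ + ‖(1 + (v : ℂ) * I) - ρ‖ := norm_add_le _ _
        _ ≤ r + r := by
            refine add_le_add ?_ (by rw [norm_sub_rev]; exact hρ.2)
            have : s - (1 + (v : ℂ) * I) = ((r : ℝ) : ℂ) := by rw [hs]; push_cast; ring
            rw [this, Complex.norm_real, Real.norm_eq_abs, abs_of_pos hr]
        _ = 2 * r := by ring
    have := re_inv_ge_of_re_ge_of_norm_le hr hre' hnorm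
    calc 1 / (4 * r) = r / (2 * r) ^ 2 := by field_simp; ring
      _ ≤ ((s - ρ)⁻¹).re := this
  have hsum : (∑ ρ ∈ (discZeros f v).filter (fun ρ => ‖ρ - (1 + (v : ℂ) * I)‖ ≤ r),
      (discDivisor f v ρ : ℝ)) * (1 / (4 * r)) ≤ 1 / r + K₀ + E := by
    rw [Finset.sum_mul]
    calc ∑ ρ ∈ (discZeros f v).filter (fun ρ => ‖ρ - (1 + (v : ℂ) * I)‖ ≤ r),
          (discDivisor f v ρ : ℝ) * (1 / (4 * r))
        ≤ ∑ ρ ∈ (discZeros f v).filter (fun ρ => ‖ρ - (1 + (v : ℂ) * I)‖ ≤ r),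
          (discDivisor f v ρ : ℝ) * ((s - ρ)⁻¹).re := Finset.sum_le_sum hnear
      _ ≤ ∑ ρ ∈ discZeros f v, (discDivisor f v ρ : ℝ) * ((s - ρ)⁻¹).re :=
          Finset.sum_le_sum_of_subset_of_nonneg (Finset.filter_subset _ _) fun ρ hρ _ => hterm0 ρ hρ
      _ = Sz.re := hRe_eq.symm
      _ ≤ _ := hRe
  rw [mul_one_div, div_le_iff₀ (by positivity)] at hsum
  calc ∑ ρ ∈ (discZeros f v).filter (fun ρ => ‖ρ - (1 + (v : ℂ) * I)‖ ≤ r), (discDivisor f v ρ : ℝ)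
      ≤ (1 / r + K₀ + E) * (4 * r) := hsum
    _ = 4 + 4 * r * K₀ + 4 * r * E := by field_simp

/-! ### The derivatives of `f'/f` near `σ = 1` -/

/-- **The derivatives of `f'/f` minus those of the local partial fraction** (Bombieri p. 44, Cauchy's
inequality on a circle of radius in `[1/16, 1/8]` about `s₀` avoiding the zeros), abstract: if
`|f'/f(z) − Σ_ρ m(ρ)/(z − ρ)| ≤ E` for `|z − c| ≤ 7/4` off the zeros (`c = 2 + iv`), then for
`|s₀ − c| ≤ 3/2` with `f(s₀) ≠ 0` and every `k`,
`|(f'/f)^{(k)}(s₀) − (−1)^k k! Σ_ρ m(ρ)/(s₀ − ρ)^{k+1}| ≤ k! 16^k E`.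
[cite: Bombieri1987GrandCrible, §6 Lemme A (proof)] -/
theorem norm_iteratedDeriv_logDeriv_sub_le (hf : Differentiable ℂ f) (hc : f (2 + (v : ℂ) * I) ≠ 0) {E : ℝ}
    (hE : 0 ≤ E)
    (hpf : ∀ z ∈ closedBall (2 + (v : ℂ) * I) (7 / 4), f z ≠ 0 →
      ‖logDeriv f z - ∑ ρ ∈ discZeros f v, (discDivisor f v ρ : ℂ) / (z - ρ)‖ ≤ E)
    {s₀ : ℂ} (hs₀ : s₀ ∈ closedBall (2 + (v : ℂ) * I) (3 / 2)) (hfs₀ : f s₀ ≠ 0) (k : ℕ) :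
    ‖iteratedDeriv k (logDeriv f) s₀ -
        (-1) ^ k * k.factorial * ∑ ρ ∈ discZeros f v, (discDivisor f v ρ : ℂ) / (s₀ - ρ) ^ (k + 1)‖ ≤
      k.factorial * 16 ^ k * E := by
  classical
  set c : ℂ := 2 + (v : ℂ) * I with hc'
  have hfan : AnalyticOnNhd ℂ f (closedBall c 2) := analyticOnNhd_of_differentiable hf c 2
  obtain ⟨G, hGan, hGne, hfG⟩ := Literature.Analysis.Complex.exists_eq_prod_pow_sub_mul
    (R₂ := 31 / 16) (R := 2) (by norm_num) (by norm_num) hfan hc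
  have hSeq : ((Function.locallyFinsuppWithin.finiteSupport (MeromorphicOn.divisor f (closedBall c (31 / 16)))
      (isCompact_closedBall c (31 / 16))).toFinset) = discZeros f v := rfl
  have hDeq : MeromorphicOn.divisor f (closedBall c (31 / 16)) = discDivisor f v := rfl
  rw [hSeq, hDeq] at hfG
  set S := discZeros f v with hS
  set D := discDivisor f v with hD
  set n : ℂ → ℕ := fun u => (D u).toNat with hn
  set P : ℂ → ℂ := fun z => ∏ u ∈ S, (z - u) ^ n u with hP
  set Rem : ℂ → ℂ := logDeriv G with hRem
  set Sp : ℂ → ℂ := fun z => ∑ u ∈ S, (D u : ℂ) / (z - u) with hSp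
  have hs₀mem : ‖s₀ - c‖ ≤ 3 / 2 := by rwa [mem_closedBall, dist_eq_norm] at hs₀
  -- `Rem` is analytic on `|z − c| ≤ 31/16`
  have hRem_an : ∀ z ∈ closedBall c (31 / 16), AnalyticAt ℂ Rem z := by
    intro z hz
    have hGz := hGan z (closedBall_subset_closedBall (by norm_num) hz)
    rw [hRem]
    have : logDeriv G = fun w => deriv G w / G w := by funext w; rw [logDeriv_apply]
    rw [this]
    exact hGz.deriv.div hGz (hGne z hz)
  -- off the zeros inside `|z − c| < 7/4`: `f'/f = Sp + Rem`
  have hident : ∀ z ∈ ball c (7 / 4), z ∉ S → logDeriv f z = Sp z + Rem z := by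
    intro z hz hzS
    have hz31 : z ∈ closedBall c (31 / 16) := by
      rw [mem_ball] at hz; rw [mem_closedBall]; linarith
    have hfz : f z ≠ 0 := fun h0 => hzS ((mem_discZeros hf hc).2 ⟨hz31, h0⟩)
    have hz' : ∀ u ∈ S, z ≠ u := fun u hu h => hzS (h ▸ hu)
    have hnhds : closedBall c 2 ∈ 𝓝 z := by
      refine mem_of_superset (isOpen_ball.mem_nhds hz) ?_
      exact ball_subset_closedBall.trans (closedBall_subset_closedBall (by norm_num))
    have hev : f =ᶠ[𝓝 z] fun w => P w * G w :=
      Filter.eventually_of_mem hnhds fun w hw => by rw [hfG w hw]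
    have h1 : logDeriv f z = logDeriv (fun w => P w * G w) z := by
      rw [logDeriv_apply, logDeriv_apply, hev.deriv_eq, hev.eq_of_nhds]
    have hPz : P z ≠ 0 := Literature.Analysis.Complex.prod_pow_sub_ne_zero n hz'
    have hGz : G z ≠ 0 := hGne z hz31
    have hPd : DifferentiableAt ℂ P z := by
      rw [hP]
      exact DifferentiableAt.fun_finsetProd fun u _ => (differentiableAt_id.sub_const u).pow (n u)
    have hGd : DifferentiableAt ℂ G z := (hGan z (closedBall_subset_closedBall (by norm_num) hz31)).differentiableAt
    rw [h1, logDeriv_mul z hPz hGz hPd hGd]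
    congr 1
    rw [logDeriv_apply, hP]
    rw [Literature.Analysis.Complex.deriv_prod_pow_sub_div n hz', hSp]
    refine Finset.sum_congr rfl fun u _ => ?_
    have h0 : 0 ≤ D u := discDivisor_nonneg hf v u
    rw [hn]; dsimp only
    rw [show ((D u).toNat : ℂ) = (((D u).toNat : ℤ) : ℂ) by norm_cast, Int.toNat_of_nonneg h0]
  have hs₀S : s₀ ∉ S := fun h => hfs₀ ((mem_discZeros hf hc).1 h).2
  have hs₀ball : s₀ ∈ ball c (7 / 4) := by rw [mem_ball, dist_eq_norm]; linarith
  have hV : (ball c (7 / 4) \ (↑S : Set ℂ)) ∈ 𝓝 s₀ :=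
    (isOpen_ball.sdiff S.finite_toSet.isClosed).mem_nhds ⟨hs₀ball, hs₀S⟩
  have hevs₀ : logDeriv f =ᶠ[𝓝 s₀] Sp + Rem :=
    Filter.eventually_of_mem hV fun z hz => by rw [Pi.add_apply]; exact hident z hz.1 hz.2
  have hSp_cd : ContDiffAt ℂ k Sp s₀ := by
    rw [hSp]
    refine ContDiffAt.sum fun u hu => ?_
    exact contDiffAt_const.div (contDiffAt_id.sub contDiffAt_const) (sub_ne_zero.2 fun h => hs₀S (h ▸ hu))
  have hRem_cd : ContDiffAt ℂ k Rem s₀ :=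
    (hRem_an s₀ (by rw [mem_closedBall, dist_eq_norm]; linarith)).contDiffAt
  have hsplit : iteratedDeriv k (logDeriv f) s₀ = iteratedDeriv k Sp s₀ + iteratedDeriv k Rem s₀ := by
    rw [hevs₀.iteratedDeriv_eq, iteratedDeriv_add hSp_cd hRem_cd]
  have hSp_der : iteratedDeriv k Sp s₀ = (-1) ^ k * k.factorial * ∑ ρ ∈ S, (D ρ : ℂ) / (s₀ - ρ) ^ (k + 1) :=
    iteratedDeriv_sum_div_sub S (fun u => (D u : ℂ)) k hs₀S
  obtain ⟨r₁, hr₁mem, hr₁S⟩ := (Set.Icc_infinite (show (1 / 16 : ℝ) < 1 / 8 by norm_num)).exists_notMem_finset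
    (S.image fun u => ‖u - s₀‖)
  have hr₁pos : 0 < r₁ := by linarith [hr₁mem.1]
  have hbound : ∀ z ∈ sphere s₀ r₁, ‖Rem z‖ ≤ E := by
    intro z hz
    rw [mem_sphere, dist_eq_norm] at hz
    have hzc : ‖z - c‖ < 7 / 4 := by
      calc ‖z - c‖ = ‖(z - s₀) + (s₀ - c)‖ := by ring_nf
        _ ≤ ‖z - s₀‖ + ‖s₀ - c‖ := norm_add_le _ _
        _ < 7 / 4 := by rw [hz]; linarith [hr₁mem.2]
    have hzball : z ∈ ball c (7 / 4) := by rw [mem_ball, dist_eq_norm]; exact hzc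
    have hzS : z ∉ S := by
      intro hzS
      apply hr₁S
      rw [Finset.mem_image]
      exact ⟨z, hzS, hz⟩
    have hz31 : z ∈ closedBall c (31 / 16) := by rw [mem_closedBall, dist_eq_norm]; linarith
    have hfz : f z ≠ 0 := fun h0 => hzS ((mem_discZeros hf hc).2 ⟨hz31, h0⟩)
    have h := hpf z (by rw [mem_closedBall, dist_eq_norm]; exact hzc.le) hfz
    have heq : Rem z = logDeriv f z - Sp z := by rw [hident z hzball hzS]; ring
    rw [heq]
    exact h
  have hdiff : DiffContOnCl ℂ Rem (ball s₀ r₁) := by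
    refine DifferentiableOn.diffContOnCl ?_
    rw [closure_ball s₀ hr₁pos.ne']
    intro z hz
    refine (hRem_an z ?_).differentiableAt.differentiableWithinAt
    rw [mem_closedBall, dist_eq_norm] at hz ⊢
    calc ‖z - c‖ = ‖(z - s₀) + (s₀ - c)‖ := by ring_nf
      _ ≤ ‖z - s₀‖ + ‖s₀ - c‖ := norm_add_le _ _
      _ ≤ 31 / 16 := by linarith [hr₁mem.2]
  have hC := Complex.norm_iteratedDeriv_le_of_forall_mem_sphere_norm_le k hr₁pos hdiff hbound
  rw [hsplit, hSp_der, add_sub_cancel_left]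
  refine hC.trans ?_
  rw [div_eq_mul_inv, ← inv_pow]
  have hinv : r₁⁻¹ ≤ 16 := by
    rw [inv_le_comm₀ hr₁pos (by norm_num)]
    linarith [hr₁mem.1]
  have hpow : r₁⁻¹ ^ k ≤ 16 ^ k := pow_le_pow_left₀ (inv_nonneg.2 hr₁pos.le) hinv k
  have hfac : (0 : ℝ) ≤ k.factorial := by positivity
  calc (k.factorial : ℝ) * E * r₁⁻¹ ^ k = k.factorial * r₁⁻¹ ^ k * E := by ring
    _ ≤ k.factorial * 16 ^ k * E := by gcongr

end Literature.NumberTheory.LFunctions.LogFreeLocal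

end
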